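/-
Copyright (c) 2026. All rights reserved.
Released under Apache 2.0 license as described in the file LICENSE.
Authors: abc-iut cell, prover seat abc-iut-w5-d039 (wave 5, gen 7).
-/
import Literature.IUT.LogVolume.UnitLogBallTorsionCensus
import Literature.IUT.LogVolume.UnitLogWildDyadicInhabited
import HarnessLib

/-!
# `𝒪_K = p^k · log_p(𝒪_K^×)` forces every unit logarithm into `p⁻¹𝒪_K`: the dyadic census cut to
# `(e, f, m) ∈ {(1,1,1), (2,1,1)}`

Proof-only sequel (theorems, no definitions) of `UnitLogBallTorsionCensus.lean` (this seat: over `p = 2` the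
unit ball can be a `2^k · log_2(𝒪_K^×)` only at the shapes `(e, f, m, k) ∈ {(1,1,1,−2), (2,1,1,−1), (2,2,2,−1),
(4,1,3,−1)}`).  Two of the four shapes are removed here by a NORM obstruction that complements the volume count:

* `le_neg_one_of_closedBall_one_eq_zpow_smul_logUnits`: `𝒪_K = p^k · log_p(𝒪_K^×)` forces `k ≤ −1` (the
  volume constraint `m = f·(−k·e − 1) ≥ 0`), hence **every `z ∈ log_p(𝒪_K^×)` has `‖z‖ ≤ p⁻¹`**
  (`norm_le_inv_prime_of_mem_logUnits_of_…`); so ONE unit logarithm of norm `> p⁻¹` — in particular a unit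
  logarithm which is a unit — rules the homothety out (`closedBall_one_ne_zpow_smul_logUnits_of_exists_norm_gt`,
  `…_of_exists_norm_unitLog_eq_one`);
* shape `(2, 2, 2)`: abc-iut-w5-d017's `UnitLogWildDyadicInhabited` (`2 ∣ e`, `f ≥ 2` ⇒ some unit has a unit
  `2`-adic logarithm) ⇒ excluded (`closedBall_one_ne_zpow_smul_logUnits_two_of_two_dvd`);
* shape `(4, 1, 3)`: for `e(K/ℚ_2) = 4` the unit `y = 1 − ϖ³` has `‖log_2 y‖ = ‖ϖ‖² > ‖ϖ‖⁴ = 2⁻¹` (the term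
  `(1−y)²/2` dominates the logarithmic series: abc-iut-w5-d017's `LogSeriesDominantTerm`), so excluded
  (`closedBall_one_ne_zpow_smul_logUnits_two_of_absRamificationIdx_eq_four`);
* hence **`mem_of_closedBall_one_eq_zpow_smul_logUnits_two'`**: over `p = 2`, `𝒪_K = 2^k · log_2(𝒪_K^×)` forces
  `(e, f, m, k) ∈ {(1,1,1,−2), (2,1,1,−1)}` — `K ≅ ℚ_2`, or `K` a ramified quadratic extension of `ℚ_2` with
  `μ(K) = {±1}` (where the answer depends on the field: by hand, `log_2(𝒪^×) = 2𝒪` for `ℚ_2(√3)`, not for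
  `ℚ_2(√2)`; not decided here); and **`closedBall_one_ne_zpow_smul_logUnits_two_of_sq_eq_neg_one`**: if `−1` is a
  square in `K` (e.g. `K ⊇ ℚ_2(√−1)`, as at every dyadic place of a field containing `√−1` — [IUTchI] Def. 3.1 (b))
  and `e ≥ 2`, the unit ball is NO `2^k · log_2(𝒪_K^×)`.

Classical local analysis (Neukirch, *Algebraic Number Theory*, Ch. II (5.5), (5.7)); nothing here bears on the
disputed [IUTchIII] Cor. 3.12 — the R-lane consumer is `Summits/ABC/IUTFork/Thm311RealIsmDHMoverCensusDyadic.lean`.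
[cite: NeukirchANT1999, Ch. II (5.5), (5.7)] [cite: WeilBNT1967, Ch. II §2, Th. 1–2]
-/

noncomputable section

open MeasureTheory Set Metric
open scoped Pointwise
open Literature.NumberTheory.GaloisRepresentations.Ultrametric

namespace Literature.IUT.LogVolume

variable (p : ℕ) [Fact p.Prime]
variable (K : Type*) [NontriviallyNormedField K] [instK : NormedAlgebra ℚ_[p] K] [IsUltrametricDist K]
  [ProperSpace K]

/-! ## 1. The norm obstruction: a homothety `𝒪_K = p^k · log_p(𝒪_K^×)` has `k ≤ −1` -/

/-- **`𝒪_K = p^k · log_p(𝒪_K^×)` forces `k ≤ −1`** (volume: `0 ≤ m = f·(−k·e − 1)` with `f, e ≥ 1`).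
[cite: NeukirchANT1999, Ch. II (5.7)] -/
theorem le_neg_one_of_closedBall_one_eq_zpow_smul_logUnits {k : ℤ}
    (h : closedBall (0 : K) 1 = ((p : ℚ_[p]) ^ k) • logUnits K) : k ≤ -1 := by
  have H := torsionPExp_eq_of_closedBall_one_eq_zpow_smul_logUnits p K h
  have hf : (1 : ℤ) ≤ residueDegree p K := by exact_mod_cast residueDegree_pos p K
  have he : (1 : ℤ) ≤ absRamificationIdx p K := by exact_mod_cast absRamificationIdx_pos p K
  have hm : (0 : ℤ) ≤ torsionPExp p K := by exact_mod_cast Nat.zero_le _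
  by_contra hlt
  push Not at hlt
  have hk : 0 ≤ k := by omega
  have h1 : (0 : ℤ) ≤ k * absRamificationIdx p K := mul_nonneg hk (by linarith)
  have h2 : (residueDegree p K : ℤ) * (-(k * absRamificationIdx p K) - 1) < 0 :=
    mul_neg_of_pos_of_neg (by linarith) (by linarith)
  linarith

/-- **Under `𝒪_K = p^k · log_p(𝒪_K^×)` every unit logarithm lies in `p⁻¹·𝒪_K`**: `‖z‖ ≤ p⁻¹` for all
`z ∈ log_p(𝒪_K^×)` (`log_p(𝒪_K^×) = {‖y‖ ≤ p^k}` with `k ≤ −1`). [cite: NeukirchANT1999, Ch. II (5.5), (5.7)] -/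
theorem norm_le_inv_prime_of_mem_logUnits_of_closedBall_one_eq_zpow_smul_logUnits {k : ℤ}
    (h : closedBall (0 : K) 1 = ((p : ℚ_[p]) ^ k) • logUnits K) {z : K} (hz : z ∈ logUnits K) :
    ‖z‖ ≤ (p : ℝ)⁻¹ := by
  have hp : p.Prime := Fact.out
  have hp1 : (1 : ℝ) ≤ p := by exact_mod_cast hp.one_lt.le
  have hk := le_neg_one_of_closedBall_one_eq_zpow_smul_logUnits p K h
  have hΛ := (closedBall_eq_zpow_smul_iff p K 1 k (logUnits K)).1 h
  rw [hΛ, mem_closedBall_zero_iff, mul_one] at hz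
  calc ‖z‖ ≤ (p : ℝ) ^ k := hz
    _ ≤ (p : ℝ) ^ (-1 : ℤ) := zpow_le_zpow_right₀ hp1 hk
    _ = (p : ℝ)⁻¹ := zpow_neg_one _

/-- **A unit logarithm of norm `> p⁻¹` rules out `𝒪_K = p^k · log_p(𝒪_K^×)` for every `k`.**
[cite: NeukirchANT1999, Ch. II (5.5), (5.7)] -/
theorem closedBall_one_ne_zpow_smul_logUnits_of_exists_norm_gt
    (hz : ∃ z ∈ logUnits K, (p : ℝ)⁻¹ < ‖z‖) (k : ℤ) :
    closedBall (0 : K) 1 ≠ ((p : ℚ_[p]) ^ k) • logUnits K := by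
  intro h
  obtain ⟨z, hz, hlt⟩ := hz
  exact (norm_le_inv_prime_of_mem_logUnits_of_closedBall_one_eq_zpow_smul_logUnits p K h hz).not_gt hlt

/-- **A unit with a unit logarithm rules out `𝒪_K = p^k · log_p(𝒪_K^×)`** (abc-iut-w5-d017's census of such
units: `UnitLogRamificationCriterion`, `UnitLogWildDyadicInhabited`). [cite: NeukirchANT1999, Ch. II (5.5), (5.7)] -/
theorem closedBall_one_ne_zpow_smul_logUnits_of_exists_norm_unitLog_eq_one
    (hu : ∃ u : K, ‖u‖ = 1 ∧ ‖unitLog u‖ = 1) (k : ℤ) :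
    closedBall (0 : K) 1 ≠ ((p : ℚ_[p]) ^ k) • logUnits K := by
  have hp : p.Prime := Fact.out
  obtain ⟨u, hu, hlog⟩ := hu
  refine closedBall_one_ne_zpow_smul_logUnits_of_exists_norm_gt p K ⟨unitLog u, unitLog_mem_logUnits hu, ?_⟩ k
  rw [hlog]
  exact inv_lt_one_of_one_lt₀ (by exact_mod_cast hp.one_lt)

/-! ## 2. `p = 2`: the shapes `(2, 2, 2)` and `(4, 1, 3)` are excluded -/

/-- **`p = 2`, `2 ∣ e`, `f ≥ 2` ⇒ the unit ball is no `2^k · log_2(𝒪_K^×)`** (abc-iut-w5-d017: some unit has a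
unit logarithm). [cite: NeukirchANT1999, Ch. II (5.5), (5.7)] -/
theorem closedBall_one_ne_zpow_smul_logUnits_two_of_two_dvd (hp2 : p = 2) (he : 2 ∣ absRamificationIdx p K)
    (hf : 2 ≤ residueDegree p K) (k : ℤ) : closedBall (0 : K) 1 ≠ ((p : ℚ_[p]) ^ k) • logUnits K := by
  subst hp2
  exact closedBall_one_ne_zpow_smul_logUnits_of_exists_norm_unitLog_eq_one 2 K
    (RamificationCriterion.exists_norm_unitLog_eq_one_of_two_dvd he hf) k

/-- `2v + 2 ≤ 2^v` for `v ≥ 3`. [folklore] -/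
private theorem two_mul_add_two_le_two_pow {v : ℕ} (hv : 3 ≤ v) : 2 * v + 2 ≤ 2 ^ v := by
  induction v, hv using Nat.le_induction with
  | base => norm_num
  | succ n hn ih => rw [pow_succ]; omega

/-- The exponents of the logarithmic series at `‖1 − y‖ = ‖ϖ‖³`, `e = 4`, `p = 2`: the index `2` has exponent
`3·2 − 4·1 = 2`, every other index `N = n + 1` has `3N − 4·v_2(N) ≥ 3`. [cite: NeukirchANT1999, Ch. II (5.5)] -/
private theorem three_le_exponent {n : ℕ} (hn : n ≠ 1) :
    (2 : ℤ) + 1 ≤ 3 * ((n + 1 : ℕ) : ℤ) - ((4 : ℕ) : ℤ) * (padicValNat 2 (n + 1) : ℤ) := by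
  set N := n + 1 with hN
  have hN0 : N ≠ 0 := Nat.succ_ne_zero n
  have hN2 : N ≠ 2 := by omega
  set v := padicValNat 2 N with hv
  have hdvd : 2 ^ v ∣ N := pow_padicValNat_dvd
  have hle : 2 ^ v ≤ N := Nat.le_of_dvd (Nat.pos_of_ne_zero hN0) hdvd
  have key : 4 * v + 3 ≤ 3 * N := by
    rcases Nat.lt_or_ge v 3 with hv3 | hv3
    · interval_cases hv' : v
      · omega
      · -- `v = 1`: `2 ∣ N`, `N ≠ 2` ⇒ `N ≥ 4`
        have h2 : 2 ∣ N := by simpa using hdvd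
        omega
      · norm_num at hle
        omega
    · have h := two_mul_add_two_le_two_pow hv3
      omega
  push_cast
  omega

/-- **`p = 2`, `e(K/ℚ_2) = 4` ⇒ the unit `1 − ϖ³` has `‖log_2(1 − ϖ³)‖ = ‖ϖ‖²`** (the term `(1−y)²/2`, of norm
`‖ϖ‖^{6−4}`, dominates). [cite: NeukirchANT1999, Ch. II (5.5)] -/
theorem norm_unitLog_one_sub_cube_of_absRamificationIdx_eq_four (hp2 : p = 2)
    (he : absRamificationIdx p K = 4) {ϖ : Kˣ} (hϖ : IsUniformizer ϖ) :
    ‖unitLog (1 - (ϖ : K) ^ 3)‖ = ‖(ϖ : K)‖ ^ (2 : ℤ) := by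
  subst hp2
  have hρ0 : 0 < ‖(ϖ : K)‖ := norm_units_pos ϖ
  set y : K := 1 - (ϖ : K) ^ 3 with hydef
  have hy : ‖1 - y‖ = ‖(ϖ : K)‖ ^ (3 : ℤ) := by
    rw [hydef, sub_sub_cancel, norm_pow, ← zpow_natCast]
    norm_cast
  have hyP : IsPrincipal y := by
    show ‖1 - y‖ < 1
    rw [hy]
    exact zpow_lt_one₀ hρ0 hϖ.1 (by norm_num)
  rw [unitLog_of_isPrincipal 2 hyP]
  refine RamificationCriterion.norm_logSeries_eq_zpow_of_dominant 2 hϖ hyP hy 1 ?_ ?_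
  · rw [he]
    have : padicValNat 2 (1 + 1) = 1 := by norm_num
    rw [this]
    norm_num
  · intro n hn
    rw [he]
    exact three_le_exponent hn

/-- **`p = 2`, `e(K/ℚ_2) = 4` ⇒ the unit ball is no `2^k · log_2(𝒪_K^×)`** (`‖log_2(1 − ϖ³)‖ = ‖ϖ‖² > ‖ϖ‖⁴ =
2⁻¹`). [cite: NeukirchANT1999, Ch. II (5.5), (5.7)] -/
theorem closedBall_one_ne_zpow_smul_logUnits_two_of_absRamificationIdx_eq_four (hp2 : p = 2)
    (he : absRamificationIdx p K = 4) (k : ℤ) : closedBall (0 : K) 1 ≠ ((p : ℚ_[p]) ^ k) • logUnits K := by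
  obtain ⟨ϖ, hϖ⟩ := exists_isUniformizer (F := K)
  have hρ0 : 0 < ‖(ϖ : K)‖ := norm_units_pos ϖ
  refine closedBall_one_ne_zpow_smul_logUnits_of_exists_norm_gt p K ⟨unitLog (1 - (ϖ : K) ^ 3),
    unitLog_mem_logUnits ?_, ?_⟩ k
  · -- `1 − ϖ³` is a unit
    have h3 : ‖(ϖ : K) ^ 3‖ < 1 := by rw [norm_pow]; exact pow_lt_one₀ hρ0.le hϖ.1 (by norm_num)
    have h := IsUltrametricDist.norm_add_eq_max_of_norm_ne_norm
      (x := (1 : K)) (y := -((ϖ : K) ^ 3)) (by rw [norm_one, norm_neg]; exact (ne_of_lt h3).symm)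
    rw [norm_one, norm_neg, max_eq_left h3.le, ← sub_eq_add_neg] at h
    exact h
  · rw [norm_unitLog_one_sub_cube_of_absRamificationIdx_eq_four p K hp2 he hϖ, ← norm_pow_absRamificationIdx p K hϖ,
      he, ← zpow_natCast]
    exact zpow_lt_zpow_right_of_lt_one₀ hρ0 hϖ.1 (by norm_num)

/-! ## 3. The dyadic census, final form -/

/-- **`p = 2`: `𝒪_K = 2^k · log_2(𝒪_K^×)` forces `(e, f, m, k) ∈ {(1,1,1,−2), (2,1,1,−1)}`** — `K ≅ ℚ_2`, or `K` a
ramified quadratic extension of `ℚ_2` with `μ(K) = {±1}`. [cite: NeukirchANT1999, Ch. II (5.5), (5.7)] -/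
theorem mem_of_closedBall_one_eq_zpow_smul_logUnits_two' (hp2 : p = 2) {k : ℤ}
    (h : closedBall (0 : K) 1 = ((p : ℚ_[p]) ^ k) • logUnits K) :
    (absRamificationIdx p K = 1 ∧ residueDegree p K = 1 ∧ torsionPExp p K = 1 ∧ k = -2) ∨
    (absRamificationIdx p K = 2 ∧ residueDegree p K = 1 ∧ torsionPExp p K = 1 ∧ k = -1) := by
  rcases mem_of_closedBall_one_eq_zpow_smul_logUnits_two p K hp2 h with h1 | h1 | ⟨he, hf, -, -⟩ | ⟨he, -, -, -⟩
  · exact Or.inl h1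
  · exact Or.inr h1
  · exact absurd h (closedBall_one_ne_zpow_smul_logUnits_two_of_two_dvd p K hp2 (by rw [he]) (by rw [hf]) k)
  · exact absurd h (closedBall_one_ne_zpow_smul_logUnits_two_of_absRamificationIdx_eq_four p K hp2 he k)

/-- **`p = 2`, `e ≥ 2`, `(e, f) ≠ (2, 1)` ⇒ the unit ball is no `2^k · log_2(𝒪_K^×)`.**
[cite: NeukirchANT1999, Ch. II (5.5), (5.7)] -/
theorem closedBall_one_ne_zpow_smul_logUnits_two' (hp2 : p = 2) (he : 2 ≤ absRamificationIdx p K)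
    (hne : ¬ (absRamificationIdx p K = 2 ∧ residueDegree p K = 1)) (k : ℤ) :
    closedBall (0 : K) 1 ≠ ((p : ℚ_[p]) ^ k) • logUnits K := by
  intro h
  rcases mem_of_closedBall_one_eq_zpow_smul_logUnits_two' p K hp2 h with ⟨h1, -, -, -⟩ | ⟨h1, h2, -, -⟩
  · omega
  · exact hne ⟨h1, h2⟩

/-- **`p = 2`, `e ≥ 2`, `m ≥ 2` ⇒ the unit ball is no `2^k · log_2(𝒪_K^×)`** (the only surviving ramified shape
has `m = 1`). [cite: NeukirchANT1999, Ch. II (5.5), (5.7)] -/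
theorem closedBall_one_ne_zpow_smul_logUnits_two_of_two_le_torsionPExp (hp2 : p = 2)
    (he : 2 ≤ absRamificationIdx p K) (hm : 2 ≤ torsionPExp p K) (k : ℤ) :
    closedBall (0 : K) 1 ≠ ((p : ℚ_[p]) ^ k) • logUnits K := by
  intro h
  rcases mem_of_closedBall_one_eq_zpow_smul_logUnits_two' p K hp2 h with ⟨h1, -, -, -⟩ | ⟨-, -, h3, -⟩
  · omega
  · omega

/-- **If `−1` is a square in `K` then `m ≥ 2`** (`√−1` is a unit of order `4`). [cite: NeukirchANT1999, Ch. II (5.7)] -/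
theorem two_le_torsionPExp_of_sq_eq_neg_one (hp2 : p = 2) {i : K} (hi : i ^ 2 = -1) :
    2 ≤ torsionPExp p K := by
  classical
  subst hp2
  haveI := Literature.NumberTheory.Transcendental.IwasawaLog.charZero 2 (F := K)
  haveI := finite_torsionUnits 2 K
  have hi4 : i ^ 4 = 1 := by
    rw [show (4 : ℕ) = 2 * 2 from rfl, pow_mul, hi]; norm_num
  have hi0 : i ≠ 0 := by
    rintro rfl
    norm_num at hi
  have hi2 : i ^ 2 ≠ 1 := by
    rw [hi]; norm_num
  set u : Kˣ := Units.mk0 i hi0 with hu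
  have hu4 : u ^ 4 = 1 := Units.ext (by rw [Units.val_pow_eq_pow_val]; exact hi4)
  have hu2 : u ^ 2 ≠ 1 := fun h => hi2 (by
    have := congrArg (fun x : Kˣ => (x : K)) h
    simpa [hu, Units.val_pow_eq_pow_val] using this)
  have hord : orderOf u = 4 := by
    have h := orderOf_eq_prime_pow (p := 2) (n := 1) (x := u) (by rw [pow_one]; exact hu2)
      (by norm_num; exact hu4)
    simpa using h
  have hmem : u ∈ torsionUnits K := by
    change IsOfFinOrder u
    exact isOfFinOrder_iff_pow_eq_one.mpr ⟨4, by norm_num, hu4⟩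
  have hdvd : 4 ∣ Nat.card (torsionUnits K) := by
    rw [← hord, ← Subgroup.orderOf_mk u hmem]
    exact orderOf_dvd_natCard _
  rw [torsionPExp]
  have hcard0 : Nat.card (torsionUnits K) ≠ 0 := Nat.card_pos.ne'
  have h4 : (4 : ℕ) = 2 ^ 2 := by norm_num
  rw [h4] at hdvd
  exact (padicValNat_dvd_iff_le hcard0).1 hdvd

/-- **`p = 2`, `−1` a square in `K`, `e ≥ 2` ⇒ the unit ball is no `2^k · log_2(𝒪_K^×)`** — e.g. at EVERY place
over `2` of a number field containing `√−1` (there `e ≥ 2` automatically; [IUTchI] Def. 3.1 (b) requires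
`√−1 ∈ F`). [cite: NeukirchANT1999, Ch. II (5.5), (5.7)] -/
theorem closedBall_one_ne_zpow_smul_logUnits_two_of_sq_eq_neg_one (hp2 : p = 2) {i : K} (hi : i ^ 2 = -1)
    (he : 2 ≤ absRamificationIdx p K) (k : ℤ) : closedBall (0 : K) 1 ≠ ((p : ℚ_[p]) ^ k) • logUnits K :=
  closedBall_one_ne_zpow_smul_logUnits_two_of_two_le_torsionPExp p K hp2 he
    (two_le_torsionPExp_of_sq_eq_neg_one p K hp2 hi) k

/-- **`−1` a square in `K` ⇒ `e(K/ℚ_2) ≥ 2`** (`√−1` is a primitive `2^{1+1}`-th root of unity: `2^1·(2−1) ∣ e`).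
[cite: NeukirchANT1999, Ch. II (7.13)] -/
theorem two_le_absRamificationIdx_two_of_sq_eq_neg_one (hp2 : p = 2) {i : K} (hi : i ^ 2 = -1) :
    2 ≤ absRamificationIdx p K := by
  have hm := two_le_torsionPExp_of_sq_eq_neg_one p K hp2 hi
  have hdvd := pow_torsionPExp_pred_mul_dvd_absRamificationIdx p K (by omega)
  subst hp2
  have hle := Nat.le_of_dvd (absRamificationIdx_pos 2 K) hdvd
  have h2 : 2 ^ 1 ≤ 2 ^ (torsionPExp 2 K - 1) := Nat.pow_le_pow_right (by norm_num) (by omega)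
  norm_num at hle
  omega

/-- **`p = 2`, `−1` a square in `K` ⇒ the unit ball is no `2^k · log_2(𝒪_K^×)`** — no ramification hypothesis
needed (`√−1 ∈ K` forces `e ≥ 2`). [cite: NeukirchANT1999, Ch. II (5.5), (5.7), (7.13)] -/
theorem closedBall_one_ne_zpow_smul_logUnits_two_of_sq_eq_neg_one' (hp2 : p = 2) {i : K} (hi : i ^ 2 = -1)
    (k : ℤ) : closedBall (0 : K) 1 ≠ ((p : ℚ_[p]) ^ k) • logUnits K :=
  closedBall_one_ne_zpow_smul_logUnits_two_of_sq_eq_neg_one p K hp2 hi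
    (two_le_absRamificationIdx_two_of_sq_eq_neg_one p K hp2 hi) k

end Literature.IUT.LogVolume

end
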